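import Summits.QuantumFields.BalabanUV.T4Continuum.Support.NE7ApeCurvedRepPointedGauge
import HarnessLib

/-!
# NE7BlockConstantExtension — ROAD (B)'s INPUT `σ̃` SUPPLIED: the BLOCK-CONSTANT extension `σ̃(y) = log u(M•⌊y∕M⌋)` of the corner values of a near-identity gauge `u` is skew,
# periodic, exact at the corners (`e^{σ̃(M•w)} = u(M•w)`), `‖σ̃‖ ≤ 2θ_u` and `‖gaugeDir_W σ̃‖ ≤ 4θ_u` for EVERY unitary `W` — no smoothness is needed or useful; file 40

Cell `pub-balaban`, rung (B)+1 sub-cell t4, lineage `b2b-balaban-t4-ne7-p1` (CRUX PROVER NE7 #1 = OWNER of row NE7), generation 78; memo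
`t4/b2b-balaban-t4-ne7-p1-g78/BUMP-CLASS-FLAT.md` §7 (i).  File F109 (over `MatrixLog`, `NE7ExpLogSecondOrder.norm_mlog_le_of_le`, `NE3.FlatLandauGaugeBond.mlog_mem_skewAdjoint_of_unitary`,
`AveragingDeficitTransport.norm_Ad_of_unitary`).
WHY.  F108 `NE7ApeCurvedRepPointedGauge.smallField_of_tanCritical_pointedGauge` (road (B) docked) DISPLAYS an extension `σ̃` of the corner values of E′'s gauge `u`: skew, periodic,
`e^{σ̃(M•w)} = u(M•w)`, `‖σ̃‖ ≤ t`, `‖gaugeDir_W σ̃‖ ≤ δ`.  Since the background `W` is NOT near `1` (only its plaquettes are small), `gaugeDir_W σ̃ = Ad_{W⁻¹}σ̃ − σ̃(·+e_κ)` is of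
size `‖σ̃‖` whatever the smoothness of `σ̃` — so the cheapest extension, CONSTANT ON BLOCKS, is as good as any: `t = 2θ_u`, `δ = 4θ_u` from E′'s `‖u − 1‖ ≤ θ_u ≤ 1∕4`
(`exists_landauRep_W`'s ninth conjunct).  THIS FILE supplies it; with it F108's displayed data are E′'s output and nothing else.
WHAT ([folklore]; 0 def, 0 sorry).  **`exists_blockConstant_extension`**: for `u` unitary, `NM`-periodic, `‖u − 1‖ ≤ θ ≤ 1∕4`, and any unitary `W`: `∃ σ̃` skew, `NM`-periodic,
`e^{σ̃(M•w)} = u(M•w)`, `‖σ̃‖ ≤ 2θ`, `‖gaugeDir_W σ̃‖ ≤ 4θ` (`M = L^k`).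
HONEST FRAMING (page 1): integer-lattice bookkeeping + `exp ∘ log`; nothing of Bałaban's asserted; no letter of the curved (APE) discharged; NOT ONE-STEP, NOT NE7; spine 0∕9;
finite T⁴ rung (B)+1 — NOT infinite volume, NOT mass gap, NOT `BetaPertH`, NOT Clay.  Continuum YM on T⁴ ⇐ BetaPertH ∧ nine spine estimates (0/9 proved); BetaPertH ⇐ (D1) ∧
(D4) ∧ CAP+tail; G-an2-4 gates asym, D1 and NE2/3/4.
-/

set_option autoImplicit false

open scoped BigOperators Matrix Matrix.Norms.L2Operator
open NormedSpace Finset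

namespace Summit.QuantumFields.BalabanUV.T4Continuum.NE7BlockConstantExtension

open Literature.MathematicalPhysics.QuantumFieldTheory.Balaban1983to89
open B7Prop1Explicit B7Prop2Explicit MatrixLog UnitaryModel
open T4AveragingDeficitWall (Ad IsUnitaryCfg)
open AveragingDeficitTransport (norm_Ad_of_unitary)
open BlockAveragePushDirGauge (gaugeDir)
open NE3EnergyShapes (IsUnitarySite IsPeriodicSite)
open NE3.FlatLandauGaugeBond (mlog_mem_skewAdjoint_of_unitary)
open NE7ExpLogSecondOrder (norm_mlog_le_of_le)

noncomputable section

variable {d : ℕ} {n : Type*} [Fintype n] [DecidableEq n]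

/-- The block of a site: `⌊y∕M⌋` componentwise (Euclidean division). [folklore] -/
theorem blk_corner {M : ℤ} (hM : M ≠ 0) (w : Site d) : (fun i => (M • w) i / M) = w := by
  funext i
  rw [Pi.smul_apply, smul_eq_mul, Int.mul_ediv_cancel_left _ hM]

/-- Translating a site by `(N·M)•e_i` translates its block by `N•e_i`. [folklore] -/
theorem blk_add_period {M : ℤ} (hM : M ≠ 0) (N : ℤ) (y : Site d) (i : Fin d) :
    (fun l => (y + (N * M) • e i) l / M) = (fun l => y l / M) + N • e i := by
  funext l
  simp only [Pi.add_apply, Pi.smul_apply, smul_eq_mul, e, Pi.single_apply]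
  split_ifs with h
  · rw [mul_one, Int.add_mul_ediv_right _ _ hM, mul_one]
  · rw [mul_zero, add_zero, mul_zero, add_zero]

/-- **THE BLOCK-CONSTANT EXTENSION** (statement in the module docstring). [folklore] -/
theorem exists_blockConstant_extension [Nonempty n] {L : ℕ} (hL : 1 ≤ L) (N k : ℕ)
    {u : Site d → (Matrix n n ℂ)ˣ} (huU : IsUnitarySite u) (huP : IsPeriodicSite u ((N * L ^ k : ℕ) : ℤ))
    {θ : ℝ} (hθ : ∀ y, ‖((u y : (Matrix n n ℂ)ˣ) : Matrix n n ℂ) - 1‖ ≤ θ) (hθ4 : θ ≤ 1 / 4)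
    {W : Site d → Fin d → (Matrix n n ℂ)ˣ} (hWu : IsUnitaryCfg W) :
    ∃ σ : Site d → Matrix n n ℂ,
      (∀ y, σ y ∈ skewAdjoint (Matrix n n ℂ)) ∧ (∀ (y : Site d) (i : Fin d), σ (y + ((N * L ^ k : ℕ) : ℤ) • e i) = σ y) ∧
      (∀ w : Site d, expUnit (σ ((((L ^ k : ℕ) : ℤ)) • w)) = u ((((L ^ k : ℕ) : ℤ)) • w)) ∧
      (∀ y, ‖σ y‖ ≤ 2 * θ) ∧ (∀ (y : Site d) (κ : Fin d), ‖gaugeDir W σ y κ‖ ≤ 4 * θ) := by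
  letI : CStarAlgebra (Matrix n n ℂ) := {}
  letI : NormedAlgebra ℚ (Matrix n n ℂ) := NormedAlgebra.restrictScalars ℚ ℝ (Matrix n n ℂ)
  set M : ℤ := ((L ^ k : ℕ) : ℤ) with hM
  have hM0 : M ≠ 0 := by
    rw [hM]; exact_mod_cast (Nat.pos_of_ne_zero (pow_ne_zero k (by omega))).ne'
  set σ : Site d → Matrix n n ℂ := fun y => mlog ((u (M • fun i => y i / M) : (Matrix n n ℂ)ˣ) : Matrix n n ℂ) with hσ
  have hσle : ∀ y, ‖σ y‖ ≤ 2 * θ := fun y => norm_mlog_le_of_le (hθ _) hθ4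
  refine ⟨σ, fun y => mlog_mem_skewAdjoint_of_unitary (huU _) ((hθ _).trans hθ4), fun y i => ?_, fun w => ?_, hσle, fun y κ => ?_⟩
  · -- periodicity
    have hP : (((N * L ^ k : ℕ) : ℤ)) = (N : ℤ) * M := by rw [hM]; push_cast; ring
    show mlog ((u (M • fun l => (y + (((N * L ^ k : ℕ) : ℤ)) • e i) l / M) : (Matrix n n ℂ)ˣ) : Matrix n n ℂ)
      = mlog ((u (M • fun l => y l / M) : (Matrix n n ℂ)ˣ) : Matrix n n ℂ)
    rw [hP, blk_add_period hM0, smul_add, smul_comm M (N : ℤ) (e i), ← mul_smul, ← hP, huP]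
  · -- exact at the corners
    refine Units.ext ?_
    have hb : (fun i => (M • w) i / M) = w := blk_corner hM0 w
    have h1 : ‖((u (M • w) : (Matrix n n ℂ)ˣ) : Matrix n n ℂ) - 1‖ < 1 := ((hθ _).trans hθ4).trans_lt (by norm_num)
    rw [val_expUnit]
    show exp (mlog ((u (M • fun i => (M • w) i / M) : (Matrix n n ℂ)ˣ) : Matrix n n ℂ)) = ((u (M • w) : (Matrix n n ℂ)ˣ) : Matrix n n ℂ)
    rw [hb, exp_mlog h1]
  · -- the gauge direction: `‖Ad_{W⁻¹}σ(y) − σ(y+e_κ)‖ ≤ 2θ + 2θ`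
    have hWi : (W y κ)⁻¹ ∈ unitaryUnits (Matrix n n ℂ) := (unitaryUnits _).inv_mem (hWu y κ)
    calc ‖gaugeDir W σ y κ‖ = ‖Ad (W y κ)⁻¹ (σ y) - σ (y + e κ)‖ := rfl
      _ ≤ ‖Ad (W y κ)⁻¹ (σ y)‖ + ‖σ (y + e κ)‖ := norm_sub_le _ _
      _ ≤ 2 * θ + 2 * θ := add_le_add (by rw [norm_Ad_of_unitary hWi]; exact hσle y) (hσle _)
      _ = 4 * θ := by ring

end

end Summit.QuantumFields.BalabanUV.T4Continuum.NE7BlockConstantExtension
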